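import Literature.AlgebraicGeometry.HodgeTheory.WeilClassesFieldDecomposableOfDivisorForm
import Mathlib.LinearAlgebra.Matrix.ToLin
import Mathlib.LinearAlgebra.Determinant
import Mathlib.LinearAlgebra.Eigenspace.Basic
import Mathlib.LinearAlgebra.Matrix.Block
import HarnessLib

/-!
# Moonen–Zarhin's Criterion (2), the decomposable rows of types 1 and 2 with a totally real centre of ANY degree: the
# MULTI-BLOCK Morita mechanism — a Rosati-orthogonal SYSTEM of matrix blocks of `B ⊗ ℂ` with different corners
# («`Δ ⊗ ℂ = ∏_τ Δ_ℂ^{(τ)}`», «`G_div(X) ⊗ ℂ = ∏_τ G_div^{(τ)}`») containing `F` forces `G_div(X) ⊆ Sl_F(V_X)`, hence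
# `W_F` decomposable and algebraic (Moonen–Zarhin 1998 §1, Criterion (2) and its proof, on the carrier)

Layer `Literature/AlgebraicGeometry/HodgeTheory`; THEOREMS ONLY — no definition, no named fact, no `sorry` (D-0026, net
debt 0).  Sequel of the seat's `WeilClassesFieldDecomposableOfMatrixUnits` (ONE block summing to `1`: `F` inside a single
simple factor of `B ⊗ ℂ`, e.g. the quaternion row with centre `ℚ`).  Here the block index `b` runs over a finite set `κ`
(the print's real places `τ ∈ Σ_{E₀}` of the centre), each block `x_b, y_b : ι → End V` having its own corner `p_b`
and multiplicity space `W_b = p_b V`; the determinant on an eigenspace is the PRODUCT over the blocks.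

## The print

B. J. J. Moonen, Yu. G. Zarhin, *Weil classes on abelian varieties*, J. reine angew. Math. 496 (1998) 83–92 =
arXiv:alg-geom/9612017 [MoonenZarhin1998WeilClasses] (held text `paper:arxiv-alg-geom_9612017`).  §1, Criterion (2)
(chunk p0003 L46–L58): for `Y` of type 1 or 2 «all classes in `W_F` are decomposable», every subfield `F ⊆ End⁰(X)`.
Proof (chunk p0003 L82–L90): «suppose that `F ⊆ B`, so that `G_div(X) ⊆ Gl_F(V_X)`.  In the cases we are considering,
the group `G_div(X)` is connected and semi-simple, so `G_div(X) ⊆ Sl_F(V_X)`, hence `G_div(X)` acts trivially on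
`W_F`.»  The structure (chunk p0002 L104–L118): «Write `Σ_{E₀}` for the set of complex (in fact real) embeddings of `E₀`.
We have `SP(V_Y, φ_Y) ⊗ ℂ = ∏_{τ ∈ Σ_{E₀}} SP(V^{(τ)}_{Y,ℂ}, φ_Y^{(τ)})` and `Δ ⊗ ℂ = ∏_{τ ∈ Σ_{E₀}} Δ_ℂ^{(τ)}`, where
`Δ_ℂ^{(τ)}` is a semi-simple `ℂ`-subalgebra of `End(V^{(τ)}_{Y,ℂ})`.  We thus see that `G_div(X) ⊗ ℂ` splits as the
direct product of `e₀` factors `G_div^{(τ)}`. … In each case `Stand` denotes the standard representation» (Table 2: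
types 1–2 give `Sp` acting on a multiplicity space).

## What is proved

§1 (namespace `Literature.LinearAlgebra`, any field `K`, `V` finite-dimensional).  A SYSTEM OF MATRIX BLOCKS on `V`:
`x, y : κ → ι → End V`, `p : κ → End V` with `y_{bi} x_{bj} = δᵢⱼ p_b`, `y_{bi} x_{b'j} = 0` (`b ≠ b'`),
`Σ_{b,i} x_{bi} y_{bi} = 1` — the units `x_{bi} y_{bj}` span `⊕_b M_ι(K) ⊆ End V` and `V ≅ ⊕_b K^ι ⊗ W_b`, `W_b = p_b V`.
* block calculus: `mul_idem_/idem_mul_/idem_/unit_mul_unit_/one_mem_span_units_/mul_mem_span_units_/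
  adjoin_le_span_units_/comm_idem_of_matrixBlocks`, `exists_eq_sum_smul_of_mem_span_units_blocks`;
* **`exists_det_restrict_eigenspace_eq_prod_pow`** — for `a = Σ c_{bij} x_{bi} y_{bj}` in the span and `u` commuting with
  the `x_{bi}` and preserving the corners: `det(u | ker(a - τ)) = ∏_b det(u | W_b)^{l_b}` (an explicit isomorphism
  `Π_{(b,α)} W_b ≅ ker(a - τ)` along bases of the `τ`-eigenvectors of the `c_b`, `LinearMap.det_conj`, and a Σ-indexed
  `det (⊕ f_s) = ∏ det f_s` — private `det_blockDiagonal'_eq_prod`, `det_pi_eq_prod`);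
* `det_restrict_range_eq_one_of_matrixBlocks` — for a non-degenerate alternating `Φ` making the blocks ORTHOGONAL
  (`Φ(x_{bi} v, w) = Φ(v, y_{bi} w)`), every `Φ`-isometry preserving `W_b` has `det(u | W_b) = 1`;
* **`det_restrict_eigenspace_eq_one_of_matrixBlocks`** — hence `det(u | ker(a - τ)) = 1`.
§2–§3 (the carrier `H¹(A(ℂ); ℂ)`, `Φ = Q_h`, `G_div(X)(ℂ) = divisorLefschetzGroup A h`; blocks inside
`B ⊗ ℂ = Algebra.adjoin ℂ (S_λ ⊗ ℂ)`, `φ^*` in their span): **`detOnEigenspace_eq_one_of_matrixBlocks`**,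
`pullbackOne_mem_adjoin_of_mem_span_units_blocks`, **`detOnEigenspace_eq_one_of_mem_divisorLefschetzGroup_of_matrixBlocks`**
(«`G_div(X) ⊆ Sl_F(V_X)`»), **`weilClassesField_le_divisorClassesSpan_of_matrixBlocks`** (`W_F ⊗ ℂ ≤ 𝒟ᵐ ⊗ ℂ` for
`P(φ) = 0`, `P` monic irreducible of degree `e`, `e · 2m = 2 dim A`, `h ∈ B¹ ⊗ ℂ` with `Q_h` non-degenerate; via the
seat's g14-#3 iff), `weilClassesField_le_hodgeClassSpan_of_matrixBlocks`,
**`weilClassesField_le_algebraicClasses_of_matrixBlocks`** (Lefschetz `(1,1)`),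
`mem_algebraicClasses_of_mem_weilClassesField_of_matrixBlocks_of_adjoin` (`φ^* ∈ ℂ[T]` for generators `T` of the span).

Scope (honest column).  The blocks are a HYPOTHESIS; this file contains no instance.  The one-block instance (a
quaternion pair) is in `WeilClassesFieldDecomposableOfMatrixUnits`; the intended multi-block instance — `X = Y^m` with
a Rosati-symmetric `ψ ∈ End(Y)`, `E = ℚ(ψ)`, `F ⊆ M_m(E)`, blocks = the spectral projectors of `ψ^*` times the matrix
units of the power (type 1 with `e₀ = [E:ℚ] > 1`) — is left to a sequel.  Nothing here identifies `B` from the Albert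
type; the exceptional rows (types 3, 4) are not touched; no algebraic groups, connectedness or classification are used.

## References

* [MoonenZarhin1998WeilClasses] B. J. J. Moonen, Yu. G. Zarhin, Weil classes on abelian varieties, J. reine angew.
  Math. 496 (1998) 83–92; arXiv:alg-geom/9612017: §1 Criterion (2) and its proof (chunk p0003 L46–L90), Lemma (1)–(3),
  Tables 1–2, «Δ ⊗ ℂ = ∏ Δ^{(τ)}» (chunk p0002 L54–L118).
* [McconnellRobson2001] J. C. McConnell, J. C. Robson, Noncommutative Noetherian Rings, GSM 30 (AMS 2001), 3.5.5–3.5.7.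
* [McDuffSalamon2017] D. McDuff, D. Salamon, Introduction to Symplectic Topology, 3rd ed. (OUP 2017), Lemma 1.1.15.
* [Milne1999LefschetzClasses] J. S. Milne, Lefschetz classes on abelian varieties, Duke Math. J. 96 (1999), Thm. 3.2,
  Cor. 4.5.
* [HornJohnson2013] R. A. Horn, C. R. Johnson, Matrix Analysis, 2nd ed. (CUP 2013), §0.9.2 (block diagonal matrices).
* [VoisinHodgeI2002] C. Voisin, Hodge Theory and Complex Algebraic Geometry I (CUP 2002), Thm. 11.30.

## Provenance

Lane `lit-hodgefound` (Track 2, Layer A), prover seat `lit-hodgefound-p21` (generation 21), row g21-#2 (sequel of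
g21-#1 `WeilClassesFieldDecomposableOfMatrixUnits`).
-/

noncomputable section

open Module

/-! ### §1 Linear algebra: systems of matrix blocks, the Morita decomposition of an eigenspace, the symplectic corners -/

namespace Literature.LinearAlgebra

section SigmaDet

/-- `det (blockDiagonal' d) = ∏ₖ det dₖ` for square blocks of different sizes (Mathlib's `Matrix.det_blockDiagonal` is the
equal-size case; via block-triangularity along an enumeration of the block index). [folklore] -/
private theorem det_blockDiagonal'_eq_prod {K : Type*} [CommRing K] {κ : Type*} [Fintype κ] [DecidableEq κ]
    {σ : κ → Type*} [∀ k, Fintype (σ k)] [∀ k, DecidableEq (σ k)] (d : ∀ k, Matrix (σ k) (σ k) K) :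
    (Matrix.blockDiagonal' d).det = ∏ k, (d k).det := by
  let e := Fintype.equivFin κ
  have hT : (Matrix.blockDiagonal' d).BlockTriangular (fun a : Σ j, σ j ↦ e a.1) := by
    rintro ⟨i, x⟩ ⟨j, y⟩ h
    exact Matrix.blockDiagonal'_apply_ne d x y fun hij ↦ absurd (congrArg (⇑e) hij.symm) (ne_of_lt h)
  rw [hT.det_fintype]
  refine (Fintype.prod_equiv e (fun k ↦ (d k).det) _ fun k ↦ ?_).symm
  let f₀ : σ k ≃ {a : Σ j, σ j // a.1 = k} :=
    { toFun := fun x ↦ ⟨⟨k, x⟩, rfl⟩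
      invFun := fun a ↦ a.2 ▸ a.1.2
      left_inv := fun _ ↦ rfl
      right_inv := by
        rintro ⟨⟨j, x⟩, h⟩
        subst h
        rfl }
  let f : σ k ≃ {a : Σ j, σ j // e a.1 = e k} :=
    f₀.trans (Equiv.subtypeEquivRight fun a ↦ e.injective.eq_iff.symm)
  rw [Matrix.toSquareBlock_def, ← Matrix.det_submatrix_equiv_self f]
  congr 1
  ext x y
  simp only [Matrix.submatrix_apply]
  exact (Matrix.blockDiagonal'_apply_eq d k x y).symm

/-- **`det (⊕ₛ fₛ) = ∏ₛ det fₛ`** for a finite family of endomorphisms of (different) finite-dimensional spaces, assembled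
on the product `Π s, V s` (Mathlib's `LinearMap.det_pi` is the constant-fibre case). [folklore] -/
private theorem det_pi_eq_prod {K : Type*} [Field K] {σ : Type*} [Fintype σ] [DecidableEq σ] {V : σ → Type*}
    [∀ s, AddCommGroup (V s)] [∀ s, Module K (V s)] [∀ s, FiniteDimensional K (V s)] (f : ∀ s, V s →ₗ[K] V s) :
    LinearMap.det (LinearMap.pi fun s ↦ (f s).comp (LinearMap.proj s)) = ∏ s, LinearMap.det (f s) := by
  classical
  let b := fun s ↦ Module.finBasis K (V s)
  let B := Pi.basis b
  have hM : LinearMap.toMatrix B B (LinearMap.pi fun s ↦ (f s).comp (LinearMap.proj s)) =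
      Matrix.blockDiagonal' fun s ↦ LinearMap.toMatrix (b s) (b s) (f s) := by
    ext ⟨s, i⟩ ⟨s', j⟩
    rw [LinearMap.toMatrix_apply, Pi.basis_apply, Pi.basis_repr]
    simp only [LinearMap.pi_apply, LinearMap.comp_apply, LinearMap.proj_apply]
    by_cases h : s = s'
    · subst h
      rw [Matrix.blockDiagonal'_apply_eq, Pi.single_eq_same, LinearMap.toMatrix_apply]
    · rw [Matrix.blockDiagonal'_apply_ne _ _ _ h, Pi.single_eq_of_ne h, map_zero, map_zero, Finsupp.zero_apply]
  rw [← LinearMap.det_toMatrix B, hM, det_blockDiagonal'_eq_prod]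
  exact Finset.prod_congr rfl fun s _ ↦ LinearMap.det_toMatrix _ _

end SigmaDet

section Blocks

variable {K V : Type*} [Field K] [AddCommGroup V] [Module K V]
variable {κ ι : Type*} [Fintype κ] [DecidableEq κ] [Fintype ι] [DecidableEq ι]
variable {x y : κ → ι → Module.End K V} {p : κ → Module.End K V}

omit [DecidableEq κ] in
/-- `x_{bi} p_b = x_{bi}` for a system of matrix BLOCKS (`y_{bi} x_{bj} = δᵢⱼ p_b`, `y_{bi} x_{b'j} = 0` for `b ≠ b'`,
`Σ_{b,i} x_{bi} y_{bi} = 1`). [cite: McconnellRobson2001, 3.5.5–3.5.6] -/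
theorem mul_idem_of_matrixBlocks (hxy : ∀ b i j, y b i * x b j = if i = j then p b else 0)
    (hcross : ∀ b b', b ≠ b' → ∀ i j, y b i * x b' j = 0) (hsum : ∑ b, ∑ i, x b i * y b i = 1) (b : κ) (i : ι) :
    x b i * p b = x b i := by
  symm
  calc x b i = (∑ b', ∑ k, x b' k * y b' k) * x b i := by rw [hsum, one_mul]
    _ = ∑ b', ∑ k, x b' k * (y b' k * x b i) := by
        rw [Finset.sum_mul]
        exact Finset.sum_congr rfl fun b' _ ↦ by
          rw [Finset.sum_mul]
          exact Finset.sum_congr rfl fun k _ ↦ mul_assoc _ _ _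
    _ = ∑ k, x b k * (y b k * x b i) := by
        rw [Finset.sum_eq_single b]
        · intro b' _ hb'
          exact Finset.sum_eq_zero fun k _ ↦ by rw [hcross b' b hb', mul_zero]
        · exact fun hb ↦ absurd (Finset.mem_univ b) hb
    _ = ∑ k, (if k = i then x b k * p b else 0) := by
        refine Finset.sum_congr rfl fun k _ ↦ ?_
        rw [hxy b k i]
        split_ifs
        · rfl
        · exact mul_zero _
    _ = x b i * p b := by rw [Finset.sum_ite_eq' Finset.univ i, if_pos (Finset.mem_univ _)]

omit [DecidableEq κ] in
/-- `p_b y_{bi} = y_{bi}`. [cite: McconnellRobson2001, 3.5.5–3.5.6] -/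
theorem idem_mul_of_matrixBlocks (hxy : ∀ b i j, y b i * x b j = if i = j then p b else 0)
    (hcross : ∀ b b', b ≠ b' → ∀ i j, y b i * x b' j = 0) (hsum : ∑ b, ∑ i, x b i * y b i = 1) (b : κ) (i : ι) :
    p b * y b i = y b i := by
  symm
  calc y b i = y b i * ∑ b', ∑ k, x b' k * y b' k := by rw [hsum, mul_one]
    _ = ∑ b', ∑ k, (y b i * x b' k) * y b' k := by
        rw [Finset.mul_sum]
        exact Finset.sum_congr rfl fun b' _ ↦ by
          rw [Finset.mul_sum]
          exact Finset.sum_congr rfl fun k _ ↦ (mul_assoc _ _ _).symm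
    _ = ∑ k, (y b i * x b k) * y b k := by
        rw [Finset.sum_eq_single b]
        · intro b' _ hb'
          exact Finset.sum_eq_zero fun k _ ↦ by rw [hcross b b' hb'.symm, zero_mul]
        · exact fun hb ↦ absurd (Finset.mem_univ b) hb
    _ = ∑ k, (if i = k then p b * y b k else 0) := by
        refine Finset.sum_congr rfl fun k _ ↦ ?_
        rw [hxy b i k]
        split_ifs
        · rfl
        · exact zero_mul _
    _ = p b * y b i := by rw [Finset.sum_ite_eq Finset.univ i, if_pos (Finset.mem_univ _)]

omit [DecidableEq κ] in
/-- `p_b² = p_b`. [cite: McconnellRobson2001, 3.5.6] -/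
theorem idem_of_matrixBlocks (hxy : ∀ b i j, y b i * x b j = if i = j then p b else 0)
    (hsum : ∑ b, ∑ i, x b i * y b i = 1) (hxp : ∀ b i, x b i * p b = x b i) (b : κ) : p b * p b = p b := by
  rcases isEmpty_or_nonempty ι with hι | ⟨⟨i⟩⟩
  · have h1 : (1 : Module.End K V) = 0 := by
      rw [← hsum]
      exact Finset.sum_eq_zero fun b _ ↦ Fintype.sum_empty _
    have h0 : ∀ f : Module.End K V, f = 0 := fun f ↦ by rw [← mul_one f, h1, mul_zero]
    rw [h0 (p b * p b), h0 (p b)]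
  · calc p b * p b = y b i * x b i * p b := by rw [hxy b i i, if_pos rfl]
      _ = y b i * x b i := by rw [mul_assoc, hxp]
      _ = p b := by rw [hxy b i i, if_pos rfl]

/-- Products of the matrix units of the blocks: `(x_{bi} y_{bj})(x_{b'k} y_{b'l}) = δ_{bb'} δ_{jk} x_{bi} y_{bl}`.
[cite: McconnellRobson2001, 3.5.5–3.5.6] -/
theorem unit_mul_unit_of_matrixBlocks (hxy : ∀ b i j, y b i * x b j = if i = j then p b else 0)
    (hcross : ∀ b b', b ≠ b' → ∀ i j, y b i * x b' j = 0) (hsum : ∑ b, ∑ i, x b i * y b i = 1)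
    (b b' : κ) (i j k l : ι) :
    (x b i * y b j) * (x b' k * y b' l) = if b = b' ∧ j = k then x b i * y b l else 0 := by
  rw [mul_assoc, ← mul_assoc (y b j)]
  by_cases hb : b = b'
  · subst hb
    rw [hxy b j k]
    split_ifs with hjk h h
    · rw [← mul_assoc, mul_idem_of_matrixBlocks hxy hcross hsum]
    · exact absurd ⟨rfl, hjk⟩ h
    · exact absurd h.2 hjk
    · rw [zero_mul, mul_zero]
  · rw [hcross b b' hb, zero_mul, mul_zero, if_neg fun h ↦ hb h.1]

omit [DecidableEq κ] [DecidableEq ι] in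
/-- `1 = Σ x_{bi} y_{bi}` lies in the span of the units of the blocks. [cite: McconnellRobson2001, 3.5.5–3.5.6] -/
theorem one_mem_span_units_of_matrixBlocks (hsum : ∑ b, ∑ i, x b i * y b i = 1) :
    (1 : Module.End K V) ∈ Submodule.span K (Set.range fun t : κ × ι × ι ↦ x t.1 t.2.1 * y t.1 t.2.2) := by
  rw [← hsum]
  exact Submodule.sum_mem _ fun b _ ↦ Submodule.sum_mem _ fun i _ ↦ Submodule.subset_span ⟨(b, i, i), rfl⟩

/-- The span of the units of the blocks is closed under multiplication (it is `⊕_b M_ι(K)`).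
[cite: McconnellRobson2001, 3.5.5–3.5.6] -/
theorem mul_mem_span_units_of_matrixBlocks (hxy : ∀ b i j, y b i * x b j = if i = j then p b else 0)
    (hcross : ∀ b b', b ≠ b' → ∀ i j, y b i * x b' j = 0) (hsum : ∑ b, ∑ i, x b i * y b i = 1)
    {f g : Module.End K V} (hf : f ∈ Submodule.span K (Set.range fun t : κ × ι × ι ↦ x t.1 t.2.1 * y t.1 t.2.2))
    (hg : g ∈ Submodule.span K (Set.range fun t : κ × ι × ι ↦ x t.1 t.2.1 * y t.1 t.2.2)) :
    f * g ∈ Submodule.span K (Set.range fun t : κ × ι × ι ↦ x t.1 t.2.1 * y t.1 t.2.2) := by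
  obtain ⟨cf, rfl⟩ := (Submodule.mem_span_range_iff_exists_fun K).1 hf
  obtain ⟨cg, rfl⟩ := (Submodule.mem_span_range_iff_exists_fun K).1 hg
  rw [Finset.sum_mul]
  refine Submodule.sum_mem _ fun t _ ↦ ?_
  rw [Finset.mul_sum]
  refine Submodule.sum_mem _ fun t' _ ↦ ?_
  rw [smul_mul_assoc, mul_smul_comm, unit_mul_unit_of_matrixBlocks hxy hcross hsum]
  refine Submodule.smul_mem _ _ (Submodule.smul_mem _ _ ?_)
  split_ifs
  · exact Submodule.subset_span ⟨(t.1, t.2.1, t'.2.2), rfl⟩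
  · exact Submodule.zero_mem _

/-- A subalgebra generated inside the span of the blocks stays inside it. [cite: McconnellRobson2001, 3.5.5–3.5.6] -/
theorem adjoin_le_span_units_of_matrixBlocks (hxy : ∀ b i j, y b i * x b j = if i = j then p b else 0)
    (hcross : ∀ b b', b ≠ b' → ∀ i j, y b i * x b' j = 0) (hsum : ∑ b, ∑ i, x b i * y b i = 1)
    {T : Set (Module.End K V)} (hT : T ⊆ Submodule.span K (Set.range fun t : κ × ι × ι ↦ x t.1 t.2.1 * y t.1 t.2.2))
    {f : Module.End K V} (hf : f ∈ Algebra.adjoin K T) :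
    f ∈ Submodule.span K (Set.range fun t : κ × ι × ι ↦ x t.1 t.2.1 * y t.1 t.2.2) := by
  have h := Algebra.adjoin_le
    (S := (Submodule.span K (Set.range fun t : κ × ι × ι ↦ x t.1 t.2.1 * y t.1 t.2.2)).toSubalgebra
      (one_mem_span_units_of_matrixBlocks hsum) fun _ _ ↦ mul_mem_span_units_of_matrixBlocks hxy hcross hsum) hT
  exact Submodule.mem_toSubalgebra.1 (h hf)

omit [DecidableEq κ] [DecidableEq ι] in
/-- Elements of the span of the blocks are the `Σ_b Σ_{ij} c_{bij} x_{bi} y_{bj}`. [cite: McconnellRobson2001, 3.5.5–3.5.6] -/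
theorem exists_eq_sum_smul_of_mem_span_units_blocks {f : Module.End K V}
    (hf : f ∈ Submodule.span K (Set.range fun t : κ × ι × ι ↦ x t.1 t.2.1 * y t.1 t.2.2)) :
    ∃ c : κ → Matrix ι ι K, f = ∑ b, ∑ i, ∑ j, c b i j • (x b i * y b j) := by
  obtain ⟨cf, rfl⟩ := (Submodule.mem_span_range_iff_exists_fun K).1 hf
  refine ⟨fun b ↦ Matrix.of fun i j ↦ cf (b, i, j), ?_⟩
  rw [Fintype.sum_prod_type]
  exact Finset.sum_congr rfl fun b _ ↦ by rw [Fintype.sum_prod_type]; rfl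

omit [DecidableEq κ] in
/-- An endomorphism commuting with all `x_{bi}`, `y_{bi}` commutes with the corners `p_b`. [cite: McconnellRobson2001, 3.5.6] -/
theorem comm_idem_of_matrixBlocks (hxy : ∀ b i j, y b i * x b j = if i = j then p b else 0)
    (hsum : ∑ b, ∑ i, x b i * y b i = 1) {u : Module.End K V} (hux : ∀ b i, u * x b i = x b i * u)
    (huy : ∀ b i, u * y b i = y b i * u) (b : κ) : u * p b = p b * u := by
  rcases isEmpty_or_nonempty ι with hι | ⟨⟨i⟩⟩
  · have h1 : (1 : Module.End K V) = 0 := by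
      rw [← hsum]
      exact Finset.sum_eq_zero fun b _ ↦ Fintype.sum_empty _
    have h0 : ∀ f : Module.End K V, f = 0 := fun f ↦ by rw [← mul_one f, h1, mul_zero]
    rw [h0 (u * p b), h0 (p b * u)]
  · have hp : p b = y b i * x b i := by rw [hxy b i i, if_pos rfl]
    rw [hp, ← mul_assoc, huy, mul_assoc, hux, mul_assoc]

/-- **MORITA DECOMPOSITION OF AN EIGENSPACE ALONG SEVERAL BLOCKS — `det(u | ker(a - τ)) = ∏_b det(u | p_b V)^{l_b}`.**
For a system of matrix blocks `x, y, p` (`y_{bi} x_{bj} = δᵢⱼ p_b`, `y_{bi} x_{b'j} = 0` for `b ≠ b'`,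
`Σ_{b,i} x_{bi} y_{bi} = 1`), an element `a = Σ_b Σ_{ij} c_{bij} x_{bi} y_{bj}` of their span and an endomorphism `u`
commuting with the `x_{bi}` and preserving the corners `W_b = p_b V`: the map
`(w_{bα}) ↦ Σ_{b,α} Σ_k ξ_{bα}(k) x_{bk} w_{bα}` (`(ξ_{bα})_α` a basis of the `τ`-eigenvectors of `c_b`) is an isomorphism
`Π_b W_b^{l_b} ≅ ker(a - τ)` intertwining `⊕ (u|W_b)` with `u|ker(a - τ)` («`V ≅ ⊕_τ Stand_τ ⊗ W_τ`»); hence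
`det(u | ker(a - τ)) = ∏_b det(u | W_b)^{l_b}`. [cite: McconnellRobson2001, 3.5.5–3.5.7]
[cite: MoonenZarhin1998WeilClasses, §1 («Δ ⊗ ℂ = ∏_τ Δ_ℂ^{(τ)}», «G_div(X) ⊗ ℂ splits as the direct product of e₀ factors G_div^{(τ)}»; chunk p0002 L104–L118)] -/
theorem exists_det_restrict_eigenspace_eq_prod_pow [FiniteDimensional K V]
    (hxy : ∀ b i j, y b i * x b j = if i = j then p b else 0)
    (hcross : ∀ b b', b ≠ b' → ∀ i j, y b i * x b' j = 0) (hsum : ∑ b, ∑ i, x b i * y b i = 1)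
    (c : κ → Matrix ι ι K) {a u : Module.End K V} (ha : a = ∑ b, ∑ i, ∑ j, c b i j • (x b i * y b j))
    (hux : ∀ b i, u * x b i = x b i * u) (τ : K)
    (hV : Set.MapsTo u (a.eigenspace τ) (a.eigenspace τ))
    (hW : ∀ b, Set.MapsTo u (LinearMap.range (p b)) (LinearMap.range (p b))) :
    ∃ l : κ → ℕ, LinearMap.det (u.restrict hV) = ∏ b, LinearMap.det (u.restrict (hW b)) ^ l b := by
  classical
  set Vτ : Submodule K V := a.eigenspace τ with hVτdef
  let W : κ → Submodule K V := fun b ↦ LinearMap.range (p b)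
  have hxp : ∀ b i, x b i * p b = x b i := mul_idem_of_matrixBlocks hxy hcross hsum
  have hpy : ∀ b i, p b * y b i = y b i := idem_mul_of_matrixBlocks hxy hcross hsum
  have hpp : ∀ b, p b * p b = p b := idem_of_matrixBlocks hxy hsum hxp
  have hpW : ∀ b, ∀ w ∈ W b, p b w = w := by
    rintro b _ ⟨v, rfl⟩
    rw [← Module.End.mul_apply, hpp]
  have hyW : ∀ b i (v : V), y b i v ∈ W b := fun b i v ↦ ⟨y b i v, by rw [← Module.End.mul_apply, hpy]⟩
  have hyx : ∀ b i j (v : V), y b i (x b j v) = if i = j then p b v else 0 := by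
    intro b i j v
    rw [← Module.End.mul_apply, hxy]
    split_ifs <;> rfl
  have hyx' : ∀ b b', b ≠ b' → ∀ i j (v : V), y b i (x b' j v) = 0 := by
    intro b b' hb i j v
    rw [← Module.End.mul_apply, hcross b b' hb, LinearMap.zero_apply]
  -- the eigenvectors of the coefficient matrices `c b`
  let L : κ → Submodule K (ι → K) := fun b ↦ Module.End.eigenspace (Matrix.toLin' (c b)) τ
  have hLmem : ∀ b (ξ : ι → K), ξ ∈ L b ↔ ∀ i, ∑ k, c b i k * ξ k = τ * ξ i := by
    intro b ξ
    rw [Module.End.mem_eigenspace_iff, Matrix.toLin'_apply, funext_iff]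
    refine forall_congr' fun i ↦ ?_
    rw [Matrix.mulVec, dotProduct, Pi.smul_apply, smul_eq_mul]
  let l : κ → ℕ := fun b ↦ Module.finrank K (L b)
  let bL := fun b ↦ Module.finBasis K (L b)
  let bW := fun b ↦ Module.finBasis K (W b)
  let ξ : ∀ b, Fin (l b) → ι → K := fun b α ↦ (bL b α : ι → K)
  have hξ : ∀ b α i, ∑ k, c b i k * ξ b α k = τ * ξ b α i := fun b α ↦ (hLmem b _).1 (bL b α).2
  -- the transplant maps `M_{bα} = Σ_k ξ_{bα}(k) x_{bk}`
  let M : ∀ b, Fin (l b) → Module.End K V := fun b α ↦ ∑ k, ξ b α k • x b k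
  have hMapply : ∀ b α v, M b α v = ∑ k, ξ b α k • x b k v := fun b α v ↦ by
    simp only [M, LinearMap.sum_apply, LinearMap.smul_apply]
  have hyM : ∀ b k α (v : V), y b k (M b α v) = ξ b α k • p b v := by
    intro b k α v
    rw [hMapply, map_sum]
    simp_rw [map_smul, hyx, smul_ite, smul_zero]
    rw [Finset.sum_ite_eq, if_pos (Finset.mem_univ _)]
  have hyM' : ∀ b b', b ≠ b' → ∀ k α (v : V), y b k (M b' α v) = 0 := by
    intro b b' hb k α v
    rw [hMapply, map_sum]
    exact Finset.sum_eq_zero fun m _ ↦ by rw [map_smul, hyx' b b' hb, smul_zero]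
  have huM : ∀ b α v, u (M b α v) = M b α (u v) := by
    intro b α v
    rw [hMapply, hMapply, map_sum]
    refine Finset.sum_congr rfl fun k _ ↦ ?_
    rw [map_smul, ← Module.End.mul_apply, hux, Module.End.mul_apply]
  have haX : ∀ b k (w : V), p b w = w → a (x b k w) = ∑ i, c b i k • x b i w := by
    intro b k w hw
    rw [ha, LinearMap.sum_apply, Finset.sum_eq_single b]
    · rw [LinearMap.sum_apply]
      refine Finset.sum_congr rfl fun i _ ↦ ?_
      rw [LinearMap.sum_apply]
      simp_rw [LinearMap.smul_apply, Module.End.mul_apply, hyx, apply_ite (x b i), map_zero, smul_ite, smul_zero]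
      rw [Finset.sum_ite_eq' Finset.univ k, if_pos (Finset.mem_univ _), hw]
    · intro b' _ hb'
      rw [LinearMap.sum_apply]
      exact Finset.sum_eq_zero fun i _ ↦ by
        rw [LinearMap.sum_apply]
        exact Finset.sum_eq_zero fun j _ ↦ by
          rw [LinearMap.smul_apply, Module.End.mul_apply, hyx' b' b hb', map_zero, smul_zero]
    · exact fun hb ↦ absurd (Finset.mem_univ b) hb
  have haM : ∀ b α (w : V), w ∈ W b → a (M b α w) = τ • M b α w := by
    intro b α w hw
    rw [hMapply, map_sum, Finset.smul_sum]
    simp_rw [map_smul, haX b _ w (hpW b w hw), Finset.smul_sum, smul_smul, mul_comm (ξ b α _) (c b _ _)]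
    rw [Finset.sum_comm]
    exact Finset.sum_congr rfl fun i _ ↦ by rw [← Finset.sum_smul, hξ b α i]
  have hMV : ∀ b α (w : V), w ∈ W b → M b α w ∈ Vτ := fun b α w hw ↦
    Module.End.mem_eigenspace_iff.2 (haM b α w hw)
  -- `Θ : Π_{(b,α)} W_b → V_τ`, `f ↦ Σ_{(b,α)} M_{bα} (f (b,α))`
  let Θ₀ : (∀ s : (Σ b, Fin (l b)), W s.1) →ₗ[K] V :=
    ∑ s : (Σ b, Fin (l b)), (M s.1 s.2 ∘ₗ (W s.1).subtype) ∘ₗ LinearMap.proj s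
  have hΘ₀ : ∀ f, Θ₀ f = ∑ s : (Σ b, Fin (l b)), M s.1 s.2 (f s) := fun f ↦ by
    simp only [Θ₀, LinearMap.sum_apply, LinearMap.comp_apply, LinearMap.proj_apply, Submodule.subtype_apply]
  let Θ : (∀ s : (Σ b, Fin (l b)), W s.1) →ₗ[K] Vτ :=
    Θ₀.codRestrict Vτ fun f ↦ by rw [hΘ₀]; exact Submodule.sum_mem _ fun s _ ↦ hMV s.1 s.2 _ (f s).2
  have hΘ : ∀ f, (Θ f : V) = ∑ s : (Σ b, Fin (l b)), M s.1 s.2 (f s) := fun f ↦ hΘ₀ f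
  have hΘ' : ∀ f, (Θ f : V) = ∑ b, ∑ α, M b α (f ⟨b, α⟩) := fun f ↦ by
    rw [hΘ, ← Finset.univ_sigma_univ, Finset.sum_sigma]
  -- blockwise coordinates: `y_{bk} (Θ f) = Σ_α ξ_{bα}(k) f_{bα}`
  have hyΘ : ∀ f b k, y b k (Θ f : V) = ∑ α, ξ b α k • (f ⟨b, α⟩ : V) := by
    intro f b k
    rw [hΘ', map_sum, Finset.sum_eq_single b]
    · rw [map_sum]
      exact Finset.sum_congr rfl fun α _ ↦ by rw [hyM, hpW b _ (f ⟨b, α⟩).2]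
    · intro b' _ hb'
      rw [map_sum]
      exact Finset.sum_eq_zero fun α _ ↦ hyM' b b' hb'.symm _ _ _
    · exact fun hb ↦ absurd (Finset.mem_univ b) hb
  -- `Σ_α ξ_{bα}(k) • w_{bα} = 0` for all `b, k` forces `w = 0`
  have hsep : ∀ f : (∀ s : (Σ b, Fin (l b)), W s.1),
      (∀ b k, ∑ α, ξ b α k • (f ⟨b, α⟩ : V) = 0) → f = 0 := by
    intro f hf
    have hco : ∀ b j α, (bW b).repr (f ⟨b, α⟩) j = 0 := by
      intro b j
      let fb : Fin (l b) → W b := fun α ↦ f ⟨b, α⟩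
      have hfb : ∀ k, ∑ α, ξ b α k • (fb α : V) = 0 := fun k ↦ hf b k
      have hlin : ∑ α, (bW b).repr (fb α) j • bL b α = 0 := by
        apply Subtype.ext
        rw [Submodule.coe_sum, Submodule.coe_zero]
        funext k
        simp only [Finset.sum_apply, Submodule.coe_smul, Pi.smul_apply, smul_eq_mul, Pi.zero_apply]
        have hk' : (∑ α, ξ b α k • fb α : W b) = 0 := by
          apply Subtype.ext
          rw [Submodule.coe_sum, Submodule.coe_zero]
          simpa only [Submodule.coe_smul] using hfb k
        have := congrArg (fun w : W b ↦ (bW b).repr w j) hk'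
        simp only [map_sum, map_smul, Finsupp.coe_finsetSum, Finsupp.coe_smul, Finset.sum_apply,
          Pi.smul_apply, smul_eq_mul, map_zero, Finsupp.coe_zero, Pi.zero_apply] at this
        simpa only [mul_comm] using this
      exact Fintype.linearIndependent_iff.1 (bL b).linearIndependent _ hlin
    funext ⟨b, α⟩
    exact (bW b).ext_elem fun j ↦ by rw [hco b j α, Pi.zero_apply, map_zero, Finsupp.zero_apply]
  have hΘinj : Function.Injective Θ := by
    rw [← LinearMap.ker_eq_bot, LinearMap.ker_eq_bot']
    intro f hf
    refine hsep f fun b k ↦ ?_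
    rw [← hyΘ, hf, Submodule.coe_zero, map_zero]
  have hΘsurj : Function.Surjective Θ := by
    rintro ⟨v, hv⟩
    have hav : a v = τ • v := Module.End.mem_eigenspace_iff.1 hv
    -- `Σ_m c_{bkm} • y_{bm} v = τ • y_{bk} v`
    have hK5 : ∀ b k, ∑ m, c b k m • y b m v = τ • y b k v := by
      intro b k
      have h := congrArg (y b k) hav
      rw [map_smul, ha, LinearMap.sum_apply, map_sum, Finset.sum_eq_single b] at h
      · rw [LinearMap.sum_apply, map_sum] at h
        simp_rw [LinearMap.sum_apply, map_sum, LinearMap.smul_apply, map_smul, Module.End.mul_apply, hyx,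
          smul_ite, smul_zero] at h
        rw [Finset.sum_comm] at h
        have hpyv : ∀ m, p b (y b m v) = y b m v := fun m ↦ hpW b _ (hyW b m v)
        simpa only [Finset.sum_ite_eq, Finset.mem_univ, if_true, hpyv] using h
      · intro b' _ hb'
        rw [LinearMap.sum_apply, map_sum]
        exact Finset.sum_eq_zero fun i _ ↦ by
          rw [LinearMap.sum_apply, map_sum]
          exact Finset.sum_eq_zero fun j _ ↦ by
            rw [LinearMap.smul_apply, map_smul, Module.End.mul_apply, hyx' b b' hb'.symm, smul_zero]
      · exact fun hb ↦ absurd (Finset.mem_univ b) hb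
    let g : ∀ b, ι → Fin (Module.finrank K (W b)) → K := fun b k j ↦ (bW b).repr ⟨y b k v, hyW b k v⟩ j
    have hgL : ∀ b j, (fun k ↦ g b k j) ∈ L b := by
      intro b j
      refine (hLmem b _).2 fun k ↦ ?_
      have h' : (∑ m, c b k m • (⟨y b m v, hyW b m v⟩ : W b)) = τ • ⟨y b k v, hyW b k v⟩ := by
        apply Subtype.ext
        rw [Submodule.coe_sum, Submodule.coe_smul]
        simpa only [Submodule.coe_smul] using hK5 b k
      have := congrArg (fun w : W b ↦ (bW b).repr w j) h'
      simpa only [map_sum, map_smul, Finsupp.coe_finsetSum, Finsupp.coe_smul, Finset.sum_apply,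
        Pi.smul_apply, smul_eq_mul] using this
    let r : ∀ b, Fin (l b) → Fin (Module.finrank K (W b)) → K := fun b α j ↦ (bL b).repr ⟨_, hgL b j⟩ α
    have hgr : ∀ b k j, g b k j = ∑ α, r b α j * ξ b α k := by
      intro b k j
      have h := (bL b).sum_repr ⟨_, hgL b j⟩
      have h' := congrArg (fun z : L b ↦ (z : ι → K) k) h
      simp only [Submodule.coe_sum, Submodule.coe_smul, Finset.sum_apply, Pi.smul_apply, smul_eq_mul] at h'
      exact h'.symm
    have hv1 : v = ∑ b, ∑ k, x b k (y b k v) := by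
      conv_lhs => rw [← Module.End.one_apply (M := V) (R := K) v, ← hsum]
      rw [LinearMap.sum_apply]
      refine Finset.sum_congr rfl fun b _ ↦ ?_
      rw [LinearMap.sum_apply]
      rfl
    have hv2 : ∀ b k, y b k v = ∑ j, g b k j • (bW b j : V) := by
      intro b k
      have h := (bW b).sum_repr ⟨y b k v, hyW b k v⟩
      have h' := congrArg Subtype.val h
      rw [Submodule.coe_sum] at h'
      simpa only [Submodule.coe_smul] using h'.symm
    refine ⟨fun s ↦ ∑ j, r s.1 s.2 j • bW s.1 j, Subtype.ext ?_⟩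
    rw [hΘ']
    refine (?_ : _ = ∑ b, ∑ k, x b k (y b k v)).trans hv1.symm
    refine Finset.sum_congr rfl fun b _ ↦ ?_
    simp_rw [hv2, map_sum, map_smul, hgr, Finset.sum_smul, Submodule.coe_sum, Submodule.coe_smul, hMapply,
      map_sum, map_smul, Finset.smul_sum, smul_smul]
    rw [Finset.sum_comm]
    refine Finset.sum_congr rfl fun k _ ↦ ?_
    rw [Finset.sum_comm]
    exact Finset.sum_congr rfl fun j _ ↦ Finset.sum_congr rfl fun α _ ↦ by rw [mul_comm]
  -- conjugate: `u|V_τ = Θ ∘ (⊕_{(b,α)} u|W_b) ∘ Θ⁻¹`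
  let Θe : (∀ s : (Σ b, Fin (l b)), W s.1) ≃ₗ[K] Vτ := LinearEquiv.ofBijective Θ ⟨hΘinj, hΘsurj⟩
  let D : (∀ s : (Σ b, Fin (l b)), W s.1) →ₗ[K] (∀ s : (Σ b, Fin (l b)), W s.1) :=
    LinearMap.pi fun s ↦ (u.restrict (hW s.1)).comp (LinearMap.proj s)
  have hinter : (u.restrict hV) ∘ₗ Θ = Θ ∘ₗ D := by
    refine LinearMap.ext fun f ↦ Subtype.ext ?_
    rw [LinearMap.comp_apply, LinearMap.comp_apply, LinearMap.coe_restrict_apply, hΘ, hΘ, map_sum]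
    refine Finset.sum_congr rfl fun s _ ↦ ?_
    rw [huM]
    rfl
  have hconj : u.restrict hV =
      (Θe : _ →ₗ[K] Vτ) ∘ₗ D ∘ₗ (Θe.symm : Vτ →ₗ[K] (∀ s : (Σ b, Fin (l b)), W s.1)) := by
    refine LinearMap.ext fun z ↦ ?_
    have h := congrArg (fun F ↦ F (Θe.symm z)) hinter
    simp only [LinearMap.comp_apply] at h
    rw [LinearMap.comp_apply, LinearMap.comp_apply]
    change _ = Θ (D (Θe.symm z))
    rw [← h]
    have hz : Θ (Θe.symm z) = z := Θe.apply_symm_apply z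
    rw [hz]
  refine ⟨l, ?_⟩
  rw [hconj, LinearMap.det_conj, det_pi_eq_prod, ← Finset.univ_sigma_univ, Finset.prod_sigma]
  refine Finset.prod_congr rfl fun b _ ↦ ?_
  calc ∏ α : Fin (l b), LinearMap.det (u.restrict (hW (⟨b, α⟩ : Σ b, Fin (l b)).1))
      = ∏ _α : Fin (l b), LinearMap.det (u.restrict (hW b)) := rfl
    _ = LinearMap.det (u.restrict (hW b)) ^ l b := by rw [Finset.prod_const, Finset.card_univ, Fintype.card_fin]

omit [DecidableEq κ] in
/-- **THE SYMPLECTIC CORNERS — `det(u | p_b V) = 1`.** If a non-degenerate alternating form `Φ` makes the blocks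
ORTHOGONAL (`Φ(x_{bi} v, w) = Φ(v, y_{bi} w)`), every `Φ`-isometry preserving a corner `W_b = p_b V` has
`det(u | W_b) = 1` (`p_b† = p_b`, so `W_b` is a non-degenerate symplectic subspace; the factors «`G_div^{(τ)} ≅ Sp`» of the
print's Table 2). [cite: MoonenZarhin1998WeilClasses, §1 Lemma (1)–(2) and Table 2 (chunk p0002 L104–L118, p0003 L1–L12)]
[cite: McDuffSalamon2017, Lemma 1.1.15] -/
theorem det_restrict_range_eq_one_of_matrixBlocks [FiniteDimensional K V]
    (hxy : ∀ b i j, y b i * x b j = if i = j then p b else 0)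
    (hcross : ∀ b b', b ≠ b' → ∀ i j, y b i * x b' j = 0) (hsum : ∑ b, ∑ i, x b i * y b i = 1)
    (Φ : LinearMap.BilinForm K V) (halt : ∀ v, Φ v v = 0) (hsep : ∀ v, (∀ w, Φ v w = 0) → v = 0)
    (hadj : ∀ b i v w, Φ (x b i v) w = Φ v (y b i w)) {u : Module.End K V}
    (hiso : ∀ v w, Φ (u v) (u w) = Φ v w) (b : κ)
    (hW : Set.MapsTo u (LinearMap.range (p b)) (LinearMap.range (p b))) :
    LinearMap.det (u.restrict hW) = 1 := by
  have hskew : ∀ v w, Φ v w = -Φ w v := fun v w ↦ by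
    have h := halt (v + w)
    simp only [map_add, LinearMap.add_apply, halt, zero_add, add_zero] at h
    exact eq_neg_of_add_eq_zero_right h
  have hadj' : ∀ b i v w, Φ (y b i v) w = Φ v (x b i w) := fun b i v w ↦ by
    rw [hskew, ← hadj, ← hskew]
  have hpadj : ∀ v w, Φ (p b v) w = Φ v (p b w) := by
    intro v w
    rcases isEmpty_or_nonempty ι with hι | ⟨⟨i⟩⟩
    · have h1 : (1 : Module.End K V) = 0 := by
        rw [← hsum]
        exact Finset.sum_eq_zero fun b _ ↦ Fintype.sum_empty _
      have hv0 : ∀ z : V, z = 0 := fun z ↦ by rw [← Module.End.one_apply (R := K) z, h1, LinearMap.zero_apply]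
      rw [hv0 (p b v), hv0 v, map_zero, LinearMap.zero_apply, LinearMap.zero_apply]
    · have hp : p b = y b i * x b i := by rw [hxy b i i, if_pos rfl]
      rw [hp, Module.End.mul_apply, Module.End.mul_apply, hadj', hadj]
  have hpp : p b * p b = p b := idem_of_matrixBlocks hxy hsum (mul_idem_of_matrixBlocks hxy hcross hsum) b
  have hpW : ∀ w ∈ LinearMap.range (p b), p b w = w := by
    rintro _ ⟨v, rfl⟩
    rw [← Module.End.mul_apply, hpp]
  refine det_restrict_eq_one_of_isAlt_of_forall_apply_apply_eq Φ hW (fun v _ ↦ halt v)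
    (fun v hv hv0 ↦ hsep v fun w ↦ ?_) fun v _ w _ ↦ hiso v w
  rw [← hpW v hv, hpadj]
  exact hv0 _ ⟨w, rfl⟩

/-- **`det(u | ker(a - τ)) = 1` — the centraliser of a `Φ`-orthogonal SYSTEM OF MATRIX BLOCKS acts with determinant one
on every eigenspace of every element of their span.** For a non-degenerate alternating `Φ`, blocks with
`x_{bi}† = y_{bi}`, a `Φ`-isometry `u` commuting with all `x_{bi}`, `y_{bi}`, and `a = Σ c_{bij} x_{bi} y_{bj}`:
`det(u | ker(a - τ)) = ∏_b det(u | p_b V)^{l_b} = 1`. This is the print's «`G_div(X)` is connected and semi-simple, so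
`G_div(X) ⊆ Sl_F(V_X)`» for the types 1 and 2 with a totally real centre of ANY degree `e₀` (`b` runs over the blocks
`Δ_ℂ^{(τ)}`, `τ ∈ Σ_{E₀}`), rendered without algebraic groups.
[cite: MoonenZarhin1998WeilClasses, §1 proof of Criterion (2), types 1 and 2 (chunk p0003 L82–L90), with Lemma (1)–(2), Table 2 and «Δ ⊗ ℂ = ∏_τ Δ_ℂ^{(τ)}» (chunk p0002 L104–L118)]
[cite: McconnellRobson2001, 3.5.5–3.5.7] [cite: McDuffSalamon2017, Lemma 1.1.15] -/
theorem det_restrict_eigenspace_eq_one_of_matrixBlocks [FiniteDimensional K V]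
    (hxy : ∀ b i j, y b i * x b j = if i = j then p b else 0)
    (hcross : ∀ b b', b ≠ b' → ∀ i j, y b i * x b' j = 0) (hsum : ∑ b, ∑ i, x b i * y b i = 1)
    (Φ : LinearMap.BilinForm K V) (halt : ∀ v, Φ v v = 0) (hsep : ∀ v, (∀ w, Φ v w = 0) → v = 0)
    (hadj : ∀ b i v w, Φ (x b i v) w = Φ v (y b i w)) (c : κ → Matrix ι ι K) {a u : Module.End K V}
    (ha : a = ∑ b, ∑ i, ∑ j, c b i j • (x b i * y b j)) (hux : ∀ b i, u * x b i = x b i * u)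
    (huy : ∀ b i, u * y b i = y b i * u) (hiso : ∀ v w, Φ (u v) (u w) = Φ v w) (τ : K)
    (hV : Set.MapsTo u (a.eigenspace τ) (a.eigenspace τ)) :
    LinearMap.det (u.restrict hV) = 1 := by
  have hup : ∀ b, u * p b = p b * u := comm_idem_of_matrixBlocks hxy hsum hux huy
  have hW : ∀ b, Set.MapsTo u (LinearMap.range (p b)) (LinearMap.range (p b)) := by
    rintro b _ ⟨v, rfl⟩
    exact ⟨u v, by rw [← Module.End.mul_apply, ← hup, Module.End.mul_apply]⟩
  obtain ⟨l, hl⟩ := exists_det_restrict_eigenspace_eq_prod_pow hxy hcross hsum c ha hux τ hV hW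
  rw [hl]
  exact Finset.prod_eq_one fun b _ ↦ by
    rw [det_restrict_range_eq_one_of_matrixBlocks hxy hcross hsum Φ halt hsep hadj hiso b (hW b), one_pow]

end Blocks

end Literature.LinearAlgebra

/-! ### §2 The carrier `H¹(A(ℂ); ℂ)`: a `Q_h`-orthogonal system of matrix blocks of `B ⊗ ℂ` containing `φ^*` forces `G_div(X) ⊆ Sl_F(V_X)` -/

namespace Literature.AlgebraicGeometry.HodgeTheory

open CategoryTheory
open Literature.AlgebraicGeometry.Motives
open Literature.AlgebraicGeometry.VanGeemen1994 (hodgeClassSpan pullbackOne detOnEigenspace)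
open Literature.AlgebraicGeometry.Milne1999 (exists_injective_linearMap_topDegree)
open Literature.AlgebraicTopology.SingularHomology
open Literature.Barriers.HodgeConjecture (divisorClassesSpan)
open Literature.LinearAlgebra

section HodgeTheory

variable {A : AbelianVariety ℂ} {h : complexBetti A.X 2} {φ : A ⟶ A} {P : Polynomial ℤ} {e m : ℕ}
  {κ ι : Type*} [Fintype κ] [DecidableEq κ] [Fintype ι] [DecidableEq ι]
  {x y : κ → ι → Module.End ℂ (complexBetti A.X 1)} {p : κ → Module.End ℂ (complexBetti A.X 1)}
  {u : complexBetti A.X 1 ≃ₗ[ℂ] complexBetti A.X 1}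

/-- **THE MULTI-BLOCK MORITA MECHANISM ON THE CARRIER — `det(u | V_τ) = 1`.** Let `x, y : κ → ι → End(H¹(A(ℂ); ℂ))`,
`p : κ → End` be a system of matrix blocks (`y_{bi} x_{bj} = δᵢⱼ p_b`, `y_{bi} x_{b'j} = 0` for `b ≠ b'`,
`Σ_{b,i} x_{bi} y_{bi} = 1`), `Q_h`-ORTHOGONAL (`Q_h(x_{bi} v, w) = Q_h(v, y_{bi} w)`), `Q_h` non-degenerate, and `φ^*` in
their span. Then every `Q_h`-isometry `u` commuting with the `x_{bi}`, `y_{bi}` (and with `φ^*`) has `det(u | V_τ) = 1` on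
every eigenspace `V_τ = ker(φ^* - τ)` (§1 with `Φ = ℓ ∘ Q_h`, `ℓ` an injective functional on the top line).
[cite: MoonenZarhin1998WeilClasses, §1 proof of Criterion (2), types 1 and 2 (chunk p0003 L82–L90); «G_div(X) ⊗ ℂ splits as the direct product of e₀ factors G_div^{(τ)}» (chunk p0002 L104–L118)]
[cite: McconnellRobson2001, 3.5.5–3.5.7] [cite: McDuffSalamon2017, Lemma 1.1.15] -/
theorem detOnEigenspace_eq_one_of_matrixBlocks
    (hxy : ∀ b i j, y b i * x b j = if i = j then p b else 0)
    (hcross : ∀ b b', b ≠ b' → ∀ i j, y b i * x b' j = 0) (hsum : ∑ b, ∑ i, x b i * y b i = 1)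
    (hadj : ∀ b i (v w : complexBetti A.X 1), polarizationPairingOne A.X h (A.dim - 1) (x b i v) w =
      polarizationPairingOne A.X h (A.dim - 1) v (y b i w))
    (hnd : ∀ v : complexBetti A.X 1, (∀ w, polarizationPairingOne A.X h (A.dim - 1) v w = 0) → v = 0)
    (hF : pullbackOne A φ ∈ Submodule.span ℂ (Set.range fun t : κ × ι × ι ↦ x t.1 t.2.1 * y t.1 t.2.2))
    (hux : ∀ b i v, u (x b i v) = x b i (u v)) (huy : ∀ b i v, u (y b i v) = y b i (u v))
    (huQ : ∀ v w : complexBetti A.X 1, polarizationPairingOne A.X h (A.dim - 1) (u v) (u w) =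
      polarizationPairingOne A.X h (A.dim - 1) v w)
    (hc : ∀ v, u (pullbackOne A φ v) = pullbackOne A φ (u v)) (τ : ℂ) :
    detOnEigenspace u (pullbackOne A φ) hc τ = 1 := by
  classical
  haveI : Module.Finite ℂ (complexBetti A.X 1) := abelianVarietyCohomologyExteriorH1_holds.finite_one A
  obtain ⟨ℓ, hℓ⟩ := exists_injective_linearMap_topDegree A
  obtain ⟨c, hcφ⟩ := exists_eq_sum_smul_of_mem_span_units_blocks hF
  set Φ : LinearMap.BilinForm ℂ (complexBetti A.X 1) :=
    (polarizationPairingOne A.X h (A.dim - 1)).compr₂ ℓ with hΦdef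
  have hΦapply : ∀ v w, Φ v w = ℓ (polarizationPairingOne A.X h (A.dim - 1) v w) := fun _ _ ↦ rfl
  have hux' : ∀ b i, (u : complexBetti A.X 1 →ₗ[ℂ] complexBetti A.X 1) * x b i = x b i * u := fun b i ↦
    LinearMap.ext fun v ↦ by rw [Module.End.mul_apply, Module.End.mul_apply, LinearEquiv.coe_coe, hux]
  have huy' : ∀ b i, (u : complexBetti A.X 1 →ₗ[ℂ] complexBetti A.X 1) * y b i = y b i * u := fun b i ↦
    LinearMap.ext fun v ↦ by rw [Module.End.mul_apply, Module.End.mul_apply, LinearEquiv.coe_coe, huy]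
  unfold detOnEigenspace
  refine det_restrict_eigenspace_eq_one_of_matrixBlocks hxy hcross hsum Φ (fun v ↦ ?_)
    (fun v hv ↦ hnd v fun w ↦ hℓ ?_) (fun b i v w ↦ ?_) c hcφ hux' huy' (fun v w ↦ ?_) τ _
  · rw [hΦapply, polarizationPairingOne_self, map_zero]
  · rw [← hΦapply, hv w, map_zero]
  · rw [hΦapply, hΦapply, hadj]
  · rw [hΦapply, hΦapply, LinearEquiv.coe_coe, huQ]

omit [DecidableEq κ] [DecidableEq ι] in
/-- A system of blocks inside `B ⊗ ℂ` whose span contains `φ^*` puts `φ^*` in `B ⊗ ℂ` («`F ⊆ B`»).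
[cite: MoonenZarhin1998WeilClasses, §1 proof of Criterion (2) (chunk p0003 L82–L90)] -/
theorem pullbackOne_mem_adjoin_of_mem_span_units_blocks
    (hx : ∀ b i, x b i ∈ Algebra.adjoin ℂ (symmetricPullbackSpan A h : Set (Module.End ℂ (complexBetti A.X 1))))
    (hy : ∀ b i, y b i ∈ Algebra.adjoin ℂ (symmetricPullbackSpan A h : Set (Module.End ℂ (complexBetti A.X 1))))
    (hF : pullbackOne A φ ∈ Submodule.span ℂ (Set.range fun t : κ × ι × ι ↦ x t.1 t.2.1 * y t.1 t.2.2)) :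
    pullbackOne A φ ∈ Algebra.adjoin ℂ (symmetricPullbackSpan A h : Set (Module.End ℂ (complexBetti A.X 1))) := by
  obtain ⟨c, hcφ⟩ := exists_eq_sum_smul_of_mem_span_units_blocks hF
  rw [hcφ]
  exact Subalgebra.sum_mem _ fun b _ ↦ Subalgebra.sum_mem _ fun i _ ↦ Subalgebra.sum_mem _ fun j _ ↦
    Subalgebra.smul_mem _ (Subalgebra.mul_mem _ (hx b i) (hy b j)) _

/-- **«`G_div(X) ⊆ Sl_F(V_X)`» FOR `F` INSIDE A ROSATI-ORTHOGONAL SYSTEM OF MATRIX BLOCKS OF `B ⊗ ℂ`** — every complex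
abelian variety, every `h` with `Q_h` non-degenerate: if `x, y, p` is a `Q_h`-orthogonal system of matrix blocks with all
`x_{bi}, y_{bi} ∈ B ⊗ ℂ` and `φ^*` in their span, then every `u ∈ G_div(X)(ℂ)` has `det(u | V_τ) = 1` for every `τ`. The
print's «`G_div(X) ⊗ ℂ` splits as the direct product of `e₀` factors `G_div^{(τ)}`» … «connected and semi-simple, so
`G_div(X) ⊆ Sl_F(V_X)`», with the algebraic-group input replaced by the Morita structure of the blocks.
[cite: MoonenZarhin1998WeilClasses, §1 proof of Criterion (2) (chunk p0003 L82–L90); Lemma (1)–(2), Table 2 (chunk p0002 L104–L118, p0003 L1–L12)]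
[cite: McconnellRobson2001, 3.5.5–3.5.7] [cite: McDuffSalamon2017, Lemma 1.1.15] -/
theorem detOnEigenspace_eq_one_of_mem_divisorLefschetzGroup_of_matrixBlocks
    (hxy : ∀ b i j, y b i * x b j = if i = j then p b else 0)
    (hcross : ∀ b b', b ≠ b' → ∀ i j, y b i * x b' j = 0) (hsum : ∑ b, ∑ i, x b i * y b i = 1)
    (hadj : ∀ b i (v w : complexBetti A.X 1), polarizationPairingOne A.X h (A.dim - 1) (x b i v) w =
      polarizationPairingOne A.X h (A.dim - 1) v (y b i w))
    (hnd : ∀ v : complexBetti A.X 1, (∀ w, polarizationPairingOne A.X h (A.dim - 1) v w = 0) → v = 0)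
    (hx : ∀ b i, x b i ∈ Algebra.adjoin ℂ (symmetricPullbackSpan A h : Set (Module.End ℂ (complexBetti A.X 1))))
    (hy : ∀ b i, y b i ∈ Algebra.adjoin ℂ (symmetricPullbackSpan A h : Set (Module.End ℂ (complexBetti A.X 1))))
    (hF : pullbackOne A φ ∈ Submodule.span ℂ (Set.range fun t : κ × ι × ι ↦ x t.1 t.2.1 * y t.1 t.2.2))
    (hu : u ∈ divisorLefschetzGroup A h) (hc : ∀ v, u (pullbackOne A φ v) = pullbackOne A φ (u v)) (τ : ℂ) :
    detOnEigenspace u (pullbackOne A φ) hc τ = 1 :=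
  detOnEigenspace_eq_one_of_matrixBlocks hxy hcross hsum hadj hnd hF
    (fun b i v ↦ divisorLefschetzGroup_comm_of_mem_adjoin hu (hx b i) v)
    (fun b i v ↦ divisorLefschetzGroup_comm_of_mem_adjoin hu (hy b i) v) hu.2 hc τ

/-- **`W_F` IS DECOMPOSABLE FOR `F` INSIDE A ROSATI-ORTHOGONAL SYSTEM OF MATRIX BLOCKS OF `B ⊗ ℂ`** — Moonen–Zarhin's
Criterion (2), the decomposable alternative of the types 1 and 2 with a totally real centre of any degree, by the Morita
mechanism: for `P(φ) = 0` (`P ∈ ℤ[T]` monic irreducible of degree `e`, `e · 2m = 2 dim A`), `h ∈ B¹(A) ⊗ ℂ` with `Q_h`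
non-degenerate, and a `Q_h`-orthogonal system of blocks `x, y, p` of `B ⊗ ℂ` with `φ^*` in its span:
`W_F ⊗ ℂ ≤ 𝒟ᵐ ⊗ ℂ` (§2 at every root, then the seat's g14-#3
`weilClassesField_le_divisorClassesSpan_iff_forall_detOnEigenspace_eq_one_of_mem_adjoin`).
[cite: MoonenZarhin1998WeilClasses, §1 Criterion (2) and its proof (chunk p0003 L46–L90)] [cite: Milne1999LefschetzClasses, Thm. 3.2, Cor. 4.5]
[cite: McconnellRobson2001, 3.5.5–3.5.7] -/
theorem weilClassesField_le_divisorClassesSpan_of_matrixBlocks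
    (hPm : P.Monic) (hPe : P.natDegree = e) (hPirr : Irreducible (P.map (Int.castRingHom ℚ)))
    (hφ : Polynomial.eval₂ (Int.castRingHom (CategoryTheory.End A)) (φ : CategoryTheory.End A) P = 0)
    (her : e * (2 * m) = 2 * A.dim) (hh : h ∈ hodgeClassSpan A.dim A.X 1)
    (hnd : ∀ v : complexBetti A.X 1, (∀ w, polarizationPairingOne A.X h (A.dim - 1) v w = 0) → v = 0)
    (hxy : ∀ b i j, y b i * x b j = if i = j then p b else 0)
    (hcross : ∀ b b', b ≠ b' → ∀ i j, y b i * x b' j = 0) (hsum : ∑ b, ∑ i, x b i * y b i = 1)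
    (hadj : ∀ b i (v w : complexBetti A.X 1), polarizationPairingOne A.X h (A.dim - 1) (x b i v) w =
      polarizationPairingOne A.X h (A.dim - 1) v (y b i w))
    (hx : ∀ b i, x b i ∈ Algebra.adjoin ℂ (symmetricPullbackSpan A h : Set (Module.End ℂ (complexBetti A.X 1))))
    (hy : ∀ b i, y b i ∈ Algebra.adjoin ℂ (symmetricPullbackSpan A h : Set (Module.End ℂ (complexBetti A.X 1))))
    (hF : pullbackOne A φ ∈ Submodule.span ℂ (Set.range fun t : κ × ι × ι ↦ x t.1 t.2.1 * y t.1 t.2.2)) :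
    weilClassesField A φ P (2 * m) ≤ divisorClassesSpan A.X A.dim m :=
  (weilClassesField_le_divisorClassesSpan_iff_forall_detOnEigenspace_eq_one_of_mem_adjoin hPm hPe hPirr hφ her hh hnd
      (pullbackOne_mem_adjoin_of_mem_span_units_blocks hx hy hF)).2
    fun _ hu τ _ ↦
      detOnEigenspace_eq_one_of_mem_divisorLefschetzGroup_of_matrixBlocks hxy hcross hsum hadj hnd hx hy hF hu _ τ

/-- **… and consists of HODGE classes**: `W_F ⊗ ℂ ≤ 𝒟ᵐ ⊗ ℂ ≤ ℬᵐ ⊗ ℂ`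
(`divisorClassesSpan_le_hodgeClassSpan_of_isSmoothProjective`). [cite: MoonenZarhin1998WeilClasses, §1 Criterion (2) (chunk p0003 L46–L58)]
[cite: vanGeemen1994HodgeAV, §2.4] -/
theorem weilClassesField_le_hodgeClassSpan_of_matrixBlocks
    (hPm : P.Monic) (hPe : P.natDegree = e) (hPirr : Irreducible (P.map (Int.castRingHom ℚ)))
    (hφ : Polynomial.eval₂ (Int.castRingHom (CategoryTheory.End A)) (φ : CategoryTheory.End A) P = 0)
    (her : e * (2 * m) = 2 * A.dim) (hh : h ∈ hodgeClassSpan A.dim A.X 1)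
    (hnd : ∀ v : complexBetti A.X 1, (∀ w, polarizationPairingOne A.X h (A.dim - 1) v w = 0) → v = 0)
    (hxy : ∀ b i j, y b i * x b j = if i = j then p b else 0)
    (hcross : ∀ b b', b ≠ b' → ∀ i j, y b i * x b' j = 0) (hsum : ∑ b, ∑ i, x b i * y b i = 1)
    (hadj : ∀ b i (v w : complexBetti A.X 1), polarizationPairingOne A.X h (A.dim - 1) (x b i v) w =
      polarizationPairingOne A.X h (A.dim - 1) v (y b i w))
    (hx : ∀ b i, x b i ∈ Algebra.adjoin ℂ (symmetricPullbackSpan A h : Set (Module.End ℂ (complexBetti A.X 1))))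
    (hy : ∀ b i, y b i ∈ Algebra.adjoin ℂ (symmetricPullbackSpan A h : Set (Module.End ℂ (complexBetti A.X 1))))
    (hF : pullbackOne A φ ∈ Submodule.span ℂ (Set.range fun t : κ × ι × ι ↦ x t.1 t.2.1 * y t.1 t.2.2)) :
    weilClassesField A φ P (2 * m) ≤ hodgeClassSpan A.dim A.X m :=
  (weilClassesField_le_divisorClassesSpan_of_matrixBlocks hPm hPe hPirr hφ her hh hnd hxy hcross hsum hadj hx hy
      hF).trans
    (divisorClassesSpan_le_hodgeClassSpan_of_isSmoothProjective (AbelianVariety.isSmoothProjective_holds (A := A)) m)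

/-- **… and is ALGEBRAIC**: `W_F ⊗ ℂ ≤ algebraicClasses A.X m`, by the Lefschetz theorem on `(1,1)`-classes (the tree's
`lefschetzOneOne_rational_holds` through `AbelianVariety.divisorClassesSpan_le_algebraicClasses`).
[cite: MoonenZarhin1998WeilClasses, Introduction (chunk p0001 L10–L18) and §1 Criterion (2) (chunk p0003 L46–L90)]
[cite: VoisinHodgeI2002, Thm. 11.30] -/
theorem weilClassesField_le_algebraicClasses_of_matrixBlocks
    (hPm : P.Monic) (hPe : P.natDegree = e) (hPirr : Irreducible (P.map (Int.castRingHom ℚ)))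
    (hφ : Polynomial.eval₂ (Int.castRingHom (CategoryTheory.End A)) (φ : CategoryTheory.End A) P = 0)
    (her : e * (2 * m) = 2 * A.dim) (hh : h ∈ hodgeClassSpan A.dim A.X 1)
    (hnd : ∀ v : complexBetti A.X 1, (∀ w, polarizationPairingOne A.X h (A.dim - 1) v w = 0) → v = 0)
    (hxy : ∀ b i j, y b i * x b j = if i = j then p b else 0)
    (hcross : ∀ b b', b ≠ b' → ∀ i j, y b i * x b' j = 0) (hsum : ∑ b, ∑ i, x b i * y b i = 1)
    (hadj : ∀ b i (v w : complexBetti A.X 1), polarizationPairingOne A.X h (A.dim - 1) (x b i v) w =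
      polarizationPairingOne A.X h (A.dim - 1) v (y b i w))
    (hx : ∀ b i, x b i ∈ Algebra.adjoin ℂ (symmetricPullbackSpan A h : Set (Module.End ℂ (complexBetti A.X 1))))
    (hy : ∀ b i, y b i ∈ Algebra.adjoin ℂ (symmetricPullbackSpan A h : Set (Module.End ℂ (complexBetti A.X 1))))
    (hF : pullbackOne A φ ∈ Submodule.span ℂ (Set.range fun t : κ × ι × ι ↦ x t.1 t.2.1 * y t.1 t.2.2)) :
    weilClassesField A φ P (2 * m) ≤ algebraicClasses A.X m :=
  (weilClassesField_le_divisorClassesSpan_of_matrixBlocks hPm hPe hPirr hφ her hh hnd hxy hcross hsum hadj hx hy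
      hF).trans
    (AbelianVariety.divisorClassesSpan_le_algebraicClasses A
      (fun b hb hb' ↦ lefschetzOneOne_rational_holds (AbelianVariety.isSmoothProjective_holds (A := A)) b hb hb') m)

/-- Element form, for any generator set `T ⊆ span` of the blocks and `φ^* ∈ ℂ[T]`: every class of `W_F ⊗ ℂ` is a
`ℂ`-combination of algebraic classes. [cite: MoonenZarhin1998WeilClasses, Introduction (chunk p0001 L10–L18) and §1 Criterion (2) (chunk p0003 L46–L90)] -/
theorem mem_algebraicClasses_of_mem_weilClassesField_of_matrixBlocks_of_adjoin
    (hPm : P.Monic) (hPe : P.natDegree = e) (hPirr : Irreducible (P.map (Int.castRingHom ℚ)))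
    (hφ : Polynomial.eval₂ (Int.castRingHom (CategoryTheory.End A)) (φ : CategoryTheory.End A) P = 0)
    (her : e * (2 * m) = 2 * A.dim) (hh : h ∈ hodgeClassSpan A.dim A.X 1)
    (hnd : ∀ v : complexBetti A.X 1, (∀ w, polarizationPairingOne A.X h (A.dim - 1) v w = 0) → v = 0)
    (hxy : ∀ b i j, y b i * x b j = if i = j then p b else 0)
    (hcross : ∀ b b', b ≠ b' → ∀ i j, y b i * x b' j = 0) (hsum : ∑ b, ∑ i, x b i * y b i = 1)
    (hadj : ∀ b i (v w : complexBetti A.X 1), polarizationPairingOne A.X h (A.dim - 1) (x b i v) w =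
      polarizationPairingOne A.X h (A.dim - 1) v (y b i w))
    (hx : ∀ b i, x b i ∈ Algebra.adjoin ℂ (symmetricPullbackSpan A h : Set (Module.End ℂ (complexBetti A.X 1))))
    (hy : ∀ b i, y b i ∈ Algebra.adjoin ℂ (symmetricPullbackSpan A h : Set (Module.End ℂ (complexBetti A.X 1))))
    {T : Set (Module.End ℂ (complexBetti A.X 1))}
    (hT : T ⊆ Submodule.span ℂ (Set.range fun t : κ × ι × ι ↦ x t.1 t.2.1 * y t.1 t.2.2))
    (hF : pullbackOne A φ ∈ Algebra.adjoin ℂ T)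
    {c : complexBetti A.X (2 * m)} (hc : c ∈ weilClassesField A φ P (2 * m)) : c ∈ algebraicClasses A.X m :=
  weilClassesField_le_algebraicClasses_of_matrixBlocks hPm hPe hPirr hφ her hh hnd hxy hcross hsum hadj hx hy
    (adjoin_le_span_units_of_matrixBlocks hxy hcross hsum hT hF) hc

end HodgeTheory

end Literature.AlgebraicGeometry.HodgeTheory

end
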